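import Literature.AlgebraicGeometry.Frobenioids.Cor54AsPrintedArithOfRigid
import Literature.AlgebraicGeometry.Frobenioids.Cor54RigidityArithMorphisms
import HarnessLib

/-!
# Frobenioids I, Corollary 5.4 at `C_{K/F}`: the strong 1-uniqueness clause and the realification clause
# AS PRINTED — UNCONDITIONAL (sub-DAG row C54-core-arith, file 5, closer)

Mochizuki, *The geometry of Frobenioids I: the general theory*, Kyushu J. Math. **62** (2008) 293–400,
Corollary 5.4 p. 104, at the arithmetic Frobenioids `C_{K/F}` of Example 6.3 / Theorem 6.4 pp. 113–116.
[cite: MochizukiFrdI2008, Cor. 5.4 p.104]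

PROOF-ONLY file (seat abc-iut-w5-d048, L1-lead R111 (2)/R125/R127: sub-row (5); no definitions). The rigidity
`hrig` of `C_{K/F}^un-tr → C_{K/F}^rlf` is now PROVED at the data (`FrdI.Cor54Sub.hrig_arith`, file `Cor54RigidityArithMorphisms`,
seats abc-iut-w5-d227 / L1-d8 / L1-d9 / L1-d2 / w5-d048); feeding it to `Cor54AsPrintedArithOfRigid` gives,
with NO displayed binder left:

* `FrdI.Cor54Sub.strongUnique_arith` — the strong 1-uniqueness clause of Cor. 5.4 AS TYPED at `C₁ = C_{K/F}`;
* `FrdI.Cor54Sub.cor54_rlf_asPrinted_arith` — the realification clause of Cor. 5.4 AS PRINTED at `C₁ = C_{K/F}`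
  (`K/F` Galois) for every Cor. 4.11 package: existence of a 1-compatible `Ψ^rlf`, an equivalence, 1-unique among
  ALL 1-compatible `Ψ'`.
Nothing here bears on [IUTchIII] Cor. 3.12.
-/

noncomputable section

namespace Literature.AlgebraicGeometry.Frobenioids

namespace FrdI.Cor54Sub

open CategoryTheory Opposite ModelFrobenioid

universe u₂' v₂' u₂ v₂

variable {F : Type} [Field F] [NumberField F] {K : Type} [Field K] [Algebra F K]
  (hΦ : PreFrobenioid.IsPerfFactorialOn (arithDivisorFunctor F K))

/-- **The strong 1-uniqueness clause of Cor. 5.4 AS TYPED at `C₁ = C_{K/F}`, unconditional.**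
[cite: MochizukiFrdI2008, Cor. 5.4 p.104] -/
theorem strongUnique_arith
    {D₂ : Type u₂'} [Category.{v₂'} D₂] {Φ₂ : D₂ᵒᵖ ⥤ CommMonCat.{0}}
    {C₂ : Type u₂} [Category.{v₂} C₂] {F₂ : C₂ ⥤ ElemFrobenioid Φ₂} (hΦ₂ : PreFrobenioid.IsPerfFactorialOn Φ₂)
    (Ψistr : (PreFrobenioidData.ofFunctor (arithDivisorFunctor F K) (ModelFrobenioid.toElem (arithDivisorFunctor F K) (unitsFunctor F K) (divNatTrans F K))).Istr ⥤ (PreFrobenioidData.ofFunctor Φ₂ F₂).Istr)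
    (e₁ : (PreFrobenioidData.ofFunctor (arithDivisorFunctor F K) (ModelFrobenioid.toElem (arithDivisorFunctor F K) (unitsFunctor F K) (divNatTrans F K))).Untr ≌ PreFrobenioid.untrModel (ModelFrobenioid.toElem (arithDivisorFunctor F K) (unitsFunctor F K) (divNatTrans F K)))
    (e₂ : (PreFrobenioidData.ofFunctor Φ₂ F₂).Untr ≌ PreFrobenioid.untrModel F₂)
    (Ψrlf : PreFrobenioid.rlf (ModelFrobenioid.toElem (arithDivisorFunctor F K) (unitsFunctor F K) (divNatTrans F K)) hΦ ⥤ PreFrobenioid.rlf F₂ hΦ₂) [Ψrlf.IsEquivalence]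
    (hsq : Square hΦ hΦ₂ Ψistr e₁ e₂ Ψrlf)
    (Ψ' : PreFrobenioid.rlf (ModelFrobenioid.toElem (arithDivisorFunctor F K) (unitsFunctor F K) (divNatTrans F K)) hΦ ⥤ PreFrobenioid.rlf F₂ hΦ₂) (hsq' : Square hΦ hΦ₂ Ψistr e₁ e₂ Ψ') :
    Nonempty (Ψ' ≅ Ψrlf) :=
  strongUnique_arith_of_rigid hΦ (hrig_arith hΦ) hΦ₂ Ψistr e₁ e₂ Ψrlf hsq Ψ' hsq'

/-- **Cor. 5.4, realification clause AS PRINTED, at `C₁ = C_{K/F}` (`K/F` Galois), unconditional**: for every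
Cor. 4.11 package, THERE EXISTS a 1-compatible `Ψ^rlf : C_{K/F}^rlf → C₂^rlf`, an EQUIVALENCE, and EVERY
1-compatible `Ψ'` is `≅ Ψ^rlf`. [cite: MochizukiFrdI2008, Cor. 5.4 p.104] -/
theorem cor54_rlf_asPrinted_arith [IsGalois F K]
    {D₂ : Type u₂'} [Category.{v₂'} D₂] {Φ₂ : D₂ᵒᵖ ⥤ CommMonCat.{0}}
    {C₂ : Type u₂} [Category.{v₂} C₂] (F₂ : C₂ ⥤ ElemFrobenioid Φ₂) (hΦ₂ : PreFrobenioid.IsPerfFactorialOn Φ₂)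
    (hF₂ : PreFrobenioid.IsFrobenioid F₂)
    (Ψ : arithFrobenioid F K ⥤ C₂)
    (Ψistr : (PreFrobenioidData.ofFunctor (arithDivisorFunctor F K) (ModelFrobenioid.toElem (arithDivisorFunctor F K) (unitsFunctor F K) (divNatTrans F K))).Istr ⥤ (PreFrobenioidData.ofFunctor Φ₂ F₂).Istr)
    (hΨistr : Ψistr ⋙ (PreFrobenioidData.ofFunctor Φ₂ F₂).istrι ≅ (PreFrobenioidData.ofFunctor (arithDivisorFunctor F K) (ModelFrobenioid.toElem (arithDivisorFunctor F K) (unitsFunctor F K) (divNatTrans F K))).istrι ⋙ Ψ)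
    (Ψuntr : (PreFrobenioidData.ofFunctor (arithDivisorFunctor F K) (ModelFrobenioid.toElem (arithDivisorFunctor F K) (unitsFunctor F K) (divNatTrans F K))).Untr ⥤ (PreFrobenioidData.ofFunctor Φ₂ F₂).Untr)
    (s : Ψistr ⋙ (PreFrobenioidData.ofFunctor Φ₂ F₂).toUntr ≅ (PreFrobenioidData.ofFunctor (arithDivisorFunctor F K) (ModelFrobenioid.toElem (arithDivisorFunctor F K) (unitsFunctor F K) (divNatTrans F K))).toUntr ⋙ Ψuntr)
    (ΨBase : FinSubextCat F K ≌ D₂)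
    (E : PreFrobenioidData.DivisorMonoidIsoOverBase (PreFrobenioidData.ofFunctor (arithDivisorFunctor F K) (ModelFrobenioid.toElem (arithDivisorFunctor F K) (unitsFunctor F K) (divNatTrans F K))) (PreFrobenioidData.ofFunctor Φ₂ F₂) ΨBase.functor)
    (η : Ψ ⋙ (PreFrobenioidData.ofFunctor Φ₂ F₂).base ≅ (PreFrobenioidData.ofFunctor (arithDivisorFunctor F K) (ModelFrobenioid.toElem (arithDivisorFunctor F K) (unitsFunctor F K) (divNatTrans F K))).base ⋙ ΨBase.functor)
    (hdeg : ∀ ⦃A B : arithFrobenioid F K⦄ (φ : A ⟶ B),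
      (PreFrobenioidData.ofFunctor Φ₂ F₂).degFr (Ψ.map φ) = (PreFrobenioidData.ofFunctor (arithDivisorFunctor F K) (ModelFrobenioid.toElem (arithDivisorFunctor F K) (unitsFunctor F K) (divNatTrans F K))).degFr φ)
    (hdiv : ∀ ⦃A B : arithFrobenioid F K⦄ (φ : A ⟶ B),
      (PreFrobenioidData.ofFunctor Φ₂ F₂).div (Ψ.map φ) =
        (PreFrobenioidData.ofFunctor Φ₂ F₂).pull (η.hom.app A) (E.iso ((PreFrobenioidData.ofFunctor (arithDivisorFunctor F K) (ModelFrobenioid.toElem (arithDivisorFunctor F K) (unitsFunctor F K) (divNatTrans F K))).base.obj A) ((PreFrobenioidData.ofFunctor (arithDivisorFunctor F K) (ModelFrobenioid.toElem (arithDivisorFunctor F K) (unitsFunctor F K) (divNatTrans F K))).div φ)))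
    (hbirat : BiratCompat (ModelFrobenioid.toElem (arithDivisorFunctor F K) (unitsFunctor F K) (divNatTrans F K)) F₂ ΨBase.functor E) :
    ∃ Ψrlf : PreFrobenioid.rlf (ModelFrobenioid.toElem (arithDivisorFunctor F K) (unitsFunctor F K) (divNatTrans F K)) hΦ ⥤ PreFrobenioid.rlf F₂ hΦ₂,
      Ψrlf.IsEquivalence ∧
        Square hΦ hΦ₂ Ψistr (PreFrobenioid.untrComparison (ModelFrobenioid.toElem (arithDivisorFunctor F K) (unitsFunctor F K) (divNatTrans F K)) (arithFrobenioid_isFrobenioid F K))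
          (PreFrobenioid.untrComparison F₂ hF₂) Ψrlf ∧
        ∀ Ψ' : PreFrobenioid.rlf (ModelFrobenioid.toElem (arithDivisorFunctor F K) (unitsFunctor F K) (divNatTrans F K)) hΦ ⥤ PreFrobenioid.rlf F₂ hΦ₂,
          Square hΦ hΦ₂ Ψistr (PreFrobenioid.untrComparison (ModelFrobenioid.toElem (arithDivisorFunctor F K) (unitsFunctor F K) (divNatTrans F K)) (arithFrobenioid_isFrobenioid F K))
            (PreFrobenioid.untrComparison F₂ hF₂) Ψ' → Nonempty (Ψ' ≅ Ψrlf) :=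
  cor54_rlf_asPrinted_arith_of_rigid hΦ (hrig_arith hΦ) F₂ hΦ₂ hF₂ Ψ Ψistr hΨistr Ψuntr s ΨBase E η hdeg hdiv hbirat

end FrdI.Cor54Sub

end Literature.AlgebraicGeometry.Frobenioids

end
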